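import Mathlib
import HarnessLib
import Summits.Ventures.LatticeQCDFlow.Scaling.AcceptanceVolumeDecayPi
import Summits.Ventures.LatticeQCDFlow.Scaling.AcceptanceBhattacharyyaRigidityIntegral

/-!
# LatticeQCDFlow / Scaling — rigidity of the Bhattacharyya acceptance ceiling for `m` INDEPENDENT
# BLOCKS on a GENERAL space (`Measure.pi`): `acc(⊗pᵢ, ⊗qᵢ) = ∏ᵢ BCᵢ²` iff every block is hit-or-miss

HONEST FRAMING: exact (Metropolis-corrected) sampling algorithms for lattice gauge theory;
figures of merit are autocorrelation/cost numbers at stated couplings and volumes; no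
continuum-physics claim.

Venture `LatticeQCDFlow` (cell pub-lqcd), topic `Scaling`; FANOUT row 3 (`s0-u1-a`, S0-B
implementation A, GEN-14).  NEW WORK of the cell (elementary measure theory), the `m`-block
measure-theoretic form of row 3's finite `accRate_blockProd_eq_prod_bhatt_sq_iff`
(`Scaling/AcceptanceVolumeCeilingRigidity`), obtained from row 3's one-pair general-space rigidity
`meanAccept_eq_sq_integral_sqrt_iff` (`Scaling/AcceptanceBhattacharyyaRigidityIntegral`, imported)
applied ON THE PRODUCT SPACE together with the tensorisation `integral_sqrt_mul_pi` of row 3's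
`Scaling/AcceptanceVolumeDecayPi` (imported).  SETTING (as in row 3's `Scaling/AcceptanceVolume*Pi`):
a finite index type `ι` of blocks, block spaces `X i` with σ-finite reference measures `μ i`, block
targets `p i ≥ 0` (`∫ pᵢ dμᵢ = 1`) and block models `q i > 0`, the factorised pair
`P(x) = ∏ᵢ pᵢ(xᵢ)`, `Q(x) = ∏ᵢ qᵢ(xᵢ)` on `Π i, X i` with reference `Measure.pi μ`,
`acc(P, Q) = ∫∫ min(P(x)Q(x′), P(x′)Q(x))`; "hit-or-miss a.e." is spelled
`∃ c, ∀ᵐ a, 0 < p a → p a / q a = c`.  NO definition is introduced.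

* §1 DISINTEGRATION ALONG ONE BLOCK (no type transport): **`ae_ae_update_notMem`** — a
  `Measure.pi μ`-null measurable set is avoided, for a.e. assignment `y` of the other blocks and then
  `μⱼ`-a.e. value `a` of block `j`, by the configuration `update (updateFinset x₀ (univ.erase j) y) j a`
  (Mathlib's `lmarginal_erase'` on the indicator); `measure_pi_posBox_ne_zero` (the box where every
  other block carries positive target mass is charged);
* §2 **`hitOrMiss_ae_pi_iff`** — THE PRODUCT PAIR IS HIT-OR-MISS a.e. IFF EVERY BLOCK IS: (⇐) by
  `Measure.tendsto_eval_ae_ae` and `∏ (pᵢ/qᵢ) = ∏ cᵢ`; (⇒) by §1: at a charged assignment of the other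
  blocks the product ratio pins the ratio of block `j` (`hitOrMiss_ae_of_pi`);
* §3 **`meanAccept_pi_eq_prod_sq_integral_sqrt_iff`** — `acc(⊗pᵢ, ⊗qᵢ) = ∏ᵢ (∫ √(pᵢqᵢ) dμᵢ)²` iff
  every block is hit-or-miss a.e.; **`meanAccept_pi_lt_prod_sq_integral_sqrt`** — STRICT as soon as
  one block has graded weights; identical blocks: `meanAccept_pi_const_eq_pow_iff`
  (`acc_m = (BC₁²)^m ↔` hit-or-miss, `m ≥ 1`), `meanAccept_pi_const_lt_pow`.

Reading (value-free): for a flow factorising over independent blocks of a general configuration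
space, the Bhattacharyya ceiling `∏ᵢ BCᵢ²` of the equilibrium acceptance is attained exactly when
every block flow is an all-or-nothing (hit-or-miss) proposal — one block with graded importance
weights already makes the ceiling strict, on continuous state spaces exactly as on finite ones.
NOT CLAIMED: the `m`-block general-space rigidity of the product FLOOR and of the worst-block
ceiling (two-block general-space forms are row 3's `…FloorRigidityIntegralEq`,
`…CeilingRigidityIntegralEq`); any acceptance of ours; nothing re-scored.
-/

namespace Summit.Ventures.LatticeQCDFlow.Theory2

open MeasureTheory Finset Function Filter

/-! ## §1 Disintegration along one block -/

section OneBlock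

variable {ι : Type*} [Fintype ι] {X : ι → Type*} [∀ i, MeasurableSpace (X i)]
  {μ : (i : ι) → Measure (X i)} [∀ i, SigmaFinite (μ i)]

/-- **DISINTEGRATION OF A NULL SET ALONG ONE BLOCK.**  If `N ⊆ Π i, X i` is measurable and
`Measure.pi μ`-null then, for `(⊗_{i ≠ j} μᵢ)`-a.e. assignment `y` of the blocks other than `j` and
then `μⱼ`-a.e. `a`, the configuration `update (updateFinset x₀ (univ.erase j) y) j a` (block `j` set to
`a`, the other blocks set to `y`) avoids `N` — Tonelli along block `j` in Mathlib's `lmarginal` form,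
with no transport of the block types. [folklore] -/
theorem ae_ae_update_notMem [DecidableEq ι] {N : Set ((i : ι) → X i)} (hN : MeasurableSet N)
    (h0 : Measure.pi μ N = 0) (j : ι) (x₀ : (i : ι) → X i) :
    ∀ᵐ y ∂(Measure.pi fun i : ↥(univ.erase j) => μ i), ∀ᵐ a ∂(μ j),
      update (updateFinset x₀ (univ.erase j) y) j a ∉ N := by
  have hf : Measurable (N.indicator (1 : ((i : ι) → X i) → ENNReal)) :=
    measurable_one.indicator hN
  have h1 : ∫⁻ x, N.indicator 1 x ∂(Measure.pi μ) = 0 := by rw [lintegral_indicator_one hN, h0]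
  rw [lintegral_eq_lmarginal_univ x₀, lmarginal_erase' _ hf (mem_univ j)] at h1
  have hF : Measurable fun z : ((i : ↥(univ.erase j)) → X i) × X j =>
      N.indicator (1 : ((i : ι) → X i) → ENNReal)
        (update (updateFinset x₀ (univ.erase j) z.1) j z.2) :=
    hf.comp (measurable_update'.comp
      ((measurable_updateFinset.comp measurable_fst).prodMk measurable_snd))
  have hg : Measurable fun y : (i : ↥(univ.erase j)) → X i =>
      ∫⁻ a, N.indicator (1 : ((i : ι) → X i) → ENNReal)
        (update (updateFinset x₀ (univ.erase j) y) j a) ∂(μ j) :=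
    hF.lintegral_prod_right'
  have h2 : (fun y : (i : ↥(univ.erase j)) → X i =>
      ∫⁻ a, N.indicator (1 : ((i : ι) → X i) → ENNReal)
        (update (updateFinset x₀ (univ.erase j) y) j a) ∂(μ j))
      =ᵐ[Measure.pi fun i : ↥(univ.erase j) => μ i] 0 := by
    rw [← lintegral_eq_zero_iff hg]
    exact h1
  filter_upwards [h2] with y hy
  have hfa : Measurable fun a : X j => N.indicator (1 : ((i : ι) → X i) → ENNReal)
      (update (updateFinset x₀ (univ.erase j) y) j a) := hf.comp (measurable_update _)
  have hy' : (fun a : X j => N.indicator (1 : ((i : ι) → X i) → ENNReal)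
      (update (updateFinset x₀ (univ.erase j) y) j a)) =ᵐ[μ j] 0 := by
    rw [← lintegral_eq_zero_iff hfa]
    exact hy
  filter_upwards [hy'] with a ha
  intro hmem
  rw [Pi.zero_apply, Set.indicator_of_mem hmem, Pi.one_apply] at ha
  exact one_ne_zero ha

omit [Fintype ι] in
/-- **The box where every listed block carries positive target mass is charged**:
`(⊗_{i ∈ s} μᵢ)(Πᵢ {0 < pᵢ}) = ∏ᵢ μᵢ{0 < pᵢ} ≠ 0`. [folklore] -/
theorem measure_pi_posBox_ne_zero {s : Finset ι} {p : (i : ι) → X i → ℝ}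
    (hpos : ∀ i, μ i {a | 0 < p i a} ≠ 0) :
    (Measure.pi fun i : ↥s => μ i) (Set.pi Set.univ fun i : ↥s => {a : X i | 0 < p i a}) ≠ 0 := by
  rw [Measure.pi_pi]
  exact prod_ne_zero_iff.2 fun i _ => hpos i

/-- A normalised nonnegative density charges `{0 < p}`. [folklore] -/
theorem measure_pos_ne_zero_of_integral_eq_one {Y : Type*} [MeasurableSpace Y] {ν : Measure Y}
    {f : Y → ℝ} (hf0 : ∀ a, 0 ≤ f a) (hf1 : ∫ a, f a ∂ν = 1) : ν {a | 0 < f a} ≠ 0 := by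
  intro h0
  have hae : (fun a => f a) =ᵐ[ν] fun _ => (0 : ℝ) := by
    filter_upwards [measure_eq_zero_iff_ae_notMem.1 h0] with a ha
    exact le_antisymm (not_lt.1 ha) (hf0 a)
  rw [integral_congr_ae hae, integral_const, smul_zero] at hf1
  exact zero_ne_one hf1

end OneBlock

/-! ## §2 The product pair is hit-or-miss a.e. iff every block is -/

section Blocks

variable {ι : Type*} [Fintype ι] {X : ι → Type*} [∀ i, MeasurableSpace (X i)]
  {μ : (i : ι) → Measure (X i)} [∀ i, SigmaFinite (μ i)]

/-- **Hit-or-miss blocks give a hit-or-miss product** (`c = ∏ᵢ cᵢ`). [ours] -/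
theorem hitOrMiss_ae_pi_of_forall {p q : (i : ι) → X i → ℝ} (hp0 : ∀ i a, 0 ≤ p i a)
    (h : ∀ i, ∃ c : ℝ, ∀ᵐ a ∂(μ i), 0 < p i a → p i a / q i a = c) :
    ∃ c : ℝ, ∀ᵐ x ∂(Measure.pi μ),
      0 < ∏ i, p i (x i) → (∏ i, p i (x i)) / (∏ i, q i (x i)) = c := by
  choose c hc using h
  refine ⟨∏ i, c i, ?_⟩
  have hx : ∀ i, ∀ᵐ x ∂(Measure.pi μ), 0 < p i (x i) → p i (x i) / q i (x i) = c i :=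
    fun i => (Measure.tendsto_eval_ae_ae (μ := μ) (i := i)).eventually (hc i)
  filter_upwards [eventually_all.2 hx] with x hx hpos
  rw [← prod_div_distrib]
  exact prod_congr rfl fun i _ =>
    hx i ((hp0 i (x i)).lt_of_ne' (prod_ne_zero_iff.1 hpos.ne' i (mem_univ i)))

/-- **A hit-or-miss product has hit-or-miss blocks**: if `⊗pᵢ / ⊗qᵢ` is a.e. constant on `{⊗pᵢ > 0}`
then so is every `pⱼ/qⱼ` on `{pⱼ > 0}` — at an a.e.-good assignment of the other blocks carrying
positive target mass (§1) the product ratio pins the ratio of block `j`. [ours] -/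
theorem hitOrMiss_ae_of_pi {p q : (i : ι) → X i → ℝ} (hp0 : ∀ i a, 0 ≤ p i a)
    (hp1 : ∀ i, ∫ a, p i a ∂(μ i) = 1) (hq0 : ∀ i a, 0 < q i a)
    (h : ∃ c : ℝ, ∀ᵐ x ∂(Measure.pi μ),
      0 < ∏ i, p i (x i) → (∏ i, p i (x i)) / (∏ i, q i (x i)) = c) (j : ι) :
    ∃ c : ℝ, ∀ᵐ a ∂(μ j), 0 < p j a → p j a / q j a = c := by
  classical
  obtain ⟨c, hc⟩ := h
  -- a base configuration (every block space is nonempty since `∫ pᵢ = 1`)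
  have hne : ∀ i, Nonempty (X i) := fun i => by
    by_contra hem
    rw [not_nonempty_iff] at hem
    have h0 : ∫ a, p i a ∂(μ i) = 0 := by
      rw [Measure.eq_zero_of_isEmpty (μ i), integral_zero_measure]
    rw [hp1 i] at h0
    exact one_ne_zero h0
  let x₀ : (i : ι) → X i := fun i => Classical.choice (hne i)
  -- a measurable null set containing the exceptional configurations, disintegrated along block `j`
  obtain ⟨N, hsub, hN, hN0⟩ := exists_measurable_superset_of_null (ae_iff.1 hc)
  have hyz := ae_ae_update_notMem hN hN0 j x₀
  -- an assignment of the other blocks carrying positive target mass, good for a.e. `a`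
  have hpos : ∀ i, μ i {a | 0 < p i a} ≠ 0 := fun i =>
    measure_pos_ne_zero_of_integral_eq_one (hp0 i) (hp1 i)
  obtain ⟨y, hy, hya⟩ := Measure.exists_mem_of_measure_ne_zero_of_ae
    (measure_pi_posBox_ne_zero (μ := μ) (s := univ.erase j) hpos) (ae_restrict_of_ae hyz)
  have hA : 0 < ∏ i : ↥(univ.erase j), p i (y i) := prod_pos fun i _ => hy i (Set.mem_univ _)
  have hB : 0 < ∏ i : ↥(univ.erase j), q i (y i) := prod_pos fun i _ => hq0 _ _
  refine ⟨c * (∏ i : ↥(univ.erase j), q i (y i)) / ∏ i : ↥(univ.erase j), p i (y i), ?_⟩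
  filter_upwards [hya] with a ha hpa
  -- the configuration `z` : block `j` at `a`, the other blocks at `y`
  set z : (i : ι) → X i := update (updateFinset x₀ (univ.erase j) y) j a with hz
  have hzj : z j = a := by rw [hz, update_self]
  have hzi : ∀ i : ↥(univ.erase j), z i = y i := fun i => by
    rw [hz, update_of_ne (ne_of_mem_erase i.2)]
    exact dif_pos i.2
  have eP : ∏ i, p i (z i) = p j a * ∏ i : ↥(univ.erase j), p i (y i) := by
    rw [← mul_prod_erase univ (fun i => p i (z i)) (mem_univ j), hzj, ← prod_coe_sort (univ.erase j)]
    congr 1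
    exact prod_congr rfl fun i _ => by rw [hzi i]
  have eQ : ∏ i, q i (z i) = q j a * ∏ i : ↥(univ.erase j), q i (y i) := by
    rw [← mul_prod_erase univ (fun i => q i (z i)) (mem_univ j), hzj, ← prod_coe_sort (univ.erase j)]
    congr 1
    exact prod_congr rfl fun i _ => by rw [hzi i]
  -- `z` is a good configuration of positive target density
  have hgood : 0 < ∏ i, p i (z i) → (∏ i, p i (z i)) / (∏ i, q i (z i)) = c := by
    by_contra hnot
    exact ha (hsub hnot)
  have hc' := hgood (by rw [eP]; exact mul_pos hpa hA)
  rw [eP, eQ, div_eq_iff (mul_pos (hq0 j a) hB).ne'] at hc'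
  rw [div_eq_div_iff (hq0 j a).ne' hA.ne']
  linear_combination hc'

/-- **THE PRODUCT PAIR IS HIT-OR-MISS a.e. IFF EVERY BLOCK IS** (normalised nonnegative block
targets, positive block models, σ-finite block spaces). [ours] -/
theorem hitOrMiss_ae_pi_iff {p q : (i : ι) → X i → ℝ} (hp0 : ∀ i a, 0 ≤ p i a)
    (hp1 : ∀ i, ∫ a, p i a ∂(μ i) = 1) (hq0 : ∀ i a, 0 < q i a) :
    (∃ c : ℝ, ∀ᵐ x ∂(Measure.pi μ),
        0 < ∏ i, p i (x i) → (∏ i, p i (x i)) / (∏ i, q i (x i)) = c)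
      ↔ ∀ i, ∃ c : ℝ, ∀ᵐ a ∂(μ i), 0 < p i a → p i a / q i a = c :=
  ⟨fun h i => hitOrMiss_ae_of_pi hp0 hp1 hq0 h i, hitOrMiss_ae_pi_of_forall hp0⟩

/-! ## §3 The Bhattacharyya ceiling of an `m`-block flow is attained only by hit-or-miss blocks -/

/-- **RIGIDITY OF THE BHATTACHARYYA CEILING FOR `m` INDEPENDENT BLOCKS (general space).**  For
normalised nonnegative block targets and positive integrable block models on σ-finite block spaces,
`acc(⊗pᵢ, ⊗qᵢ) = ∏ᵢ (∫ √(pᵢ qᵢ) dμᵢ)²` iff every block is hit-or-miss almost everywhere. [ours] -/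
theorem meanAccept_pi_eq_prod_sq_integral_sqrt_iff {p q : (i : ι) → X i → ℝ}
    (hp0 : ∀ i a, 0 ≤ p i a) (hpm : ∀ i, Measurable (p i)) (hpi : ∀ i, Integrable (p i) (μ i))
    (hp1 : ∀ i, ∫ a, p i a ∂(μ i) = 1) (hq0 : ∀ i a, 0 < q i a) (hqm : ∀ i, Measurable (q i))
    (hqi : ∀ i, Integrable (q i) (μ i)) :
    ∫ x, ∫ x', min ((∏ i, p i (x i)) * ∏ i, q i (x' i)) ((∏ i, p i (x' i)) * ∏ i, q i (x i))
          ∂(Measure.pi μ) ∂(Measure.pi μ)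
        = ∏ i, (∫ a, Real.sqrt (p i a * q i a) ∂(μ i)) ^ 2
      ↔ ∀ i, ∃ c : ℝ, ∀ᵐ a ∂(μ i), 0 < p i a → p i a / q i a = c := by
  obtain ⟨hP0, hPm, hPi, hP1⟩ := piDensity_facts (μ := μ) hp0 hpm hpi
  obtain ⟨-, hQm, hQi, -⟩ := piDensity_facts (μ := μ) (fun i a => (hq0 i a).le) hqm hqi
  have hP1' : ∫ x, ∏ i, p i (x i) ∂(Measure.pi μ) = 1 := by
    rw [hP1]
    exact prod_eq_one fun i _ => hp1 i
  have hQ0 : ∀ x : (i : ι) → X i, 0 < ∏ i, q i (x i) := fun x => prod_pos fun i _ => hq0 i (x i)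
  have key := meanAccept_eq_sq_integral_sqrt_iff (μ := Measure.pi μ) hP0 hPm hPi hP1' hQ0 hQm hQi
  rw [integral_sqrt_mul_pi hp0 fun i a => (hq0 i a).le, ← prod_pow] at key
  rw [key]
  exact hitOrMiss_ae_pi_iff hp0 hp1 hq0

/-- **STRICT BHATTACHARYYA CEILING**: one block with graded weights (not hit-or-miss a.e.) makes
`acc(⊗pᵢ, ⊗qᵢ) < ∏ᵢ (∫ √(pᵢ qᵢ) dμᵢ)²`. [ours] -/
theorem meanAccept_pi_lt_prod_sq_integral_sqrt {p q : (i : ι) → X i → ℝ}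
    (hp0 : ∀ i a, 0 ≤ p i a) (hpm : ∀ i, Measurable (p i)) (hpi : ∀ i, Integrable (p i) (μ i))
    (hp1 : ∀ i, ∫ a, p i a ∂(μ i) = 1) (hq0 : ∀ i a, 0 < q i a) (hqm : ∀ i, Measurable (q i))
    (hqi : ∀ i, Integrable (q i) (μ i))
    (h : ∃ i, ¬ ∃ c : ℝ, ∀ᵐ a ∂(μ i), 0 < p i a → p i a / q i a = c) :
    ∫ x, ∫ x', min ((∏ i, p i (x i)) * ∏ i, q i (x' i)) ((∏ i, p i (x' i)) * ∏ i, q i (x i))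
          ∂(Measure.pi μ) ∂(Measure.pi μ)
        < ∏ i, (∫ a, Real.sqrt (p i a * q i a) ∂(μ i)) ^ 2 := by
  refine lt_of_le_of_ne (meanAccept_pi_le_prod_sq_integral_sqrt hp0 hpm hpi
    (fun i a => (hq0 i a).le) hqm hqi) fun heq => ?_
  obtain ⟨i, hi⟩ := h
  exact hi ((meanAccept_pi_eq_prod_sq_integral_sqrt_iff hp0 hpm hpi hp1 hq0 hqm hqi).1 heq i)

end Blocks

/-! ## Identical blocks -/

section Const

variable {ι : Type*} [Fintype ι] {Y : Type*} [MeasurableSpace Y] {ν : Measure Y} [SigmaFinite ν]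

/-- **Identical blocks**: for `m = card ι ≥ 1` independent copies of one block flow,
`acc(p^{⊗m}, q^{⊗m}) = (BC(p, q)²)^m` iff the block flow is hit-or-miss a.e. [ours] -/
theorem meanAccept_pi_const_eq_pow_iff [Nonempty ι] {p q : Y → ℝ} (hp0 : ∀ a, 0 ≤ p a)
    (hpm : Measurable p) (hpi : Integrable p ν) (hp1 : ∫ a, p a ∂ν = 1) (hq0 : ∀ a, 0 < q a)
    (hqm : Measurable q) (hqi : Integrable q ν) :
    ∫ x, ∫ x', min ((∏ i : ι, p (x i)) * ∏ i, q (x' i)) ((∏ i, p (x' i)) * ∏ i, q (x i))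
          ∂(Measure.pi fun _ : ι => ν) ∂(Measure.pi fun _ : ι => ν)
        = ((∫ a, Real.sqrt (p a * q a) ∂ν) ^ 2) ^ Fintype.card ι
      ↔ ∃ c : ℝ, ∀ᵐ a ∂ν, 0 < p a → p a / q a = c := by
  have h := meanAccept_pi_eq_prod_sq_integral_sqrt_iff (ι := ι) (X := fun _ => Y)
    (μ := fun _ : ι => ν) (p := fun _ => p) (q := fun _ => q) (fun _ => hp0) (fun _ => hpm)
    (fun _ => hpi) (fun _ => hp1) (fun _ => hq0) (fun _ => hqm) fun _ => hqi
  rw [prod_const, card_univ] at h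
  rw [h]
  exact ⟨fun h' => h' (Classical.arbitrary ι), fun h' _ => h'⟩

/-- **Identical graded blocks**: `acc(p^{⊗m}, q^{⊗m}) < (BC(p, q)²)^m` for `m ≥ 1` copies of a block
flow that is not hit-or-miss a.e. [ours] -/
theorem meanAccept_pi_const_lt_pow [Nonempty ι] {p q : Y → ℝ} (hp0 : ∀ a, 0 ≤ p a)
    (hpm : Measurable p) (hpi : Integrable p ν) (hp1 : ∫ a, p a ∂ν = 1) (hq0 : ∀ a, 0 < q a)
    (hqm : Measurable q) (hqi : Integrable q ν) (h : ¬ ∃ c : ℝ, ∀ᵐ a ∂ν, 0 < p a → p a / q a = c) :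
    ∫ x, ∫ x', min ((∏ i : ι, p (x i)) * ∏ i, q (x' i)) ((∏ i, p (x' i)) * ∏ i, q (x i))
          ∂(Measure.pi fun _ : ι => ν) ∂(Measure.pi fun _ : ι => ν)
        < ((∫ a, Real.sqrt (p a * q a) ∂ν) ^ 2) ^ Fintype.card ι := by
  refine lt_of_le_of_ne (meanAccept_pi_const_mem_Icc (ι := ι) hp0 hpm hpi (fun a => (hq0 a).le)
    hqm hqi).2 fun heq => ?_
  exact h ((meanAccept_pi_const_eq_pow_iff (ι := ι) hp0 hpm hpi hp1 hq0 hqm hqi).1 heq)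

end Const

end Summit.Ventures.LatticeQCDFlow.Theory2
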